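import Summits.BirchSwinnertonDyer.BirchSwinnertonDyer.Theses.FrozenTwin

/-!
# Line `tame-lambda` for the TAME sub-crux of `FrozenTwinBound` (route `FrozenTwin`, item stmt-BirchSwinnertonDyer-17173)

Crux (the route's decl `FrozenTwin.FrozenTwinBound`): for every admissible frozen-twin datum and every `k ≤ p - 2`,
`p ∤ M_k := Σ_𝔞 C(dlog 𝔞, k)·φ(x_𝔞)` ⇒ `corank_(ℤ_p) Sel_(p^∞)(E/ℚ) ≤ k`.  This line proves it on TAME data — `7 ≤ p`,
(PO) `a_p² ≢ 1 (mod p)`, CAPTURED class-group character (the strategist's sub-crux `FrozenTwinBoundTame` of the split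
`FrozenTwinBound ⟸ FrozenTwinBoundTame ∧ FrozenTwinBoundWild`, glue `Cruxes/FrozenTwinBound/SplitGlue.lean`; the split is typed and proved but its FILING is deferred to the
seat's final cycle by the gate rule, so until then this file concludes the child STATEMENT verbatim, not a decl) — by the
Λ-ADIC TRANSFER: on tame data the order-`p` class-group character `χ = ζ^dlog` is an unramified finite-order character
of `Γ = Gal(K_∞^ac/K)`, and the crux becomes the ORDER-`p`-LAYER SPECIALISATION of Bertolini–Darmon 2005 Cor. 3 in its
Selmer form.  Mechanism (all levers printed):

1. `C := char_Λ Sel_(p^∞)(E/K_∞)^∨` divides `θ_∞²` in `Λ = ℤ_p⟦Γ⟧` (anticyclotomic IMC, Euler-system direction: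
   Bertolini–Darmon 2005 Thm 1; Pollack–Weston 2011 Thm 4.1 (squarefree `N`, `p ≥ 5`, (CR)); Chida–Hsieh 2015
   Thm 6.14 (any `N`, `p ≥ 7`, (CR⁺), (PO))) — the crux side conditions make (CR)/(CR⁺) vacuous (`p ∤ q² - 1`,
   `q ∣ N`) and give `ρ̄` surjective;
2. `C ∈ J^(2·max(s⁺,s⁻))`, `J = (γ - 1)`, `s^± = corank_(ℤ_p) Sel_(p^∞)(E/ℚ), Sel_(p^∞)(E^K/ℚ)` (derived `p`-adic
   heights: Bertolini–Darmon 1995 Thm 2.23 `ord char X_∞ ≥ ρ_p = Σ_k rank S̄^(k)` + Lemma 3.1 (anti-equivariance: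
   the null-space of `⟨⟨,⟩⟩₁` on the pro-`p` Selmer group `S_p(E/K)` has rank `≥ |s⁺ - s⁻|`); their standing
   assumptions (1) `p ∤ 2·#Φ(E/𝒪_K)` ⇐ `p ∤ v_q(j)`, `p ≥ 5`; (3) ⇐ `ρ̄` surjective; (4) ⇐ (PO) + ordinary, Prop. 1.1);
3. `Λ_𝒪 = 𝒪⟦T⟧` is a domain: `T^(2m) ∣ u θ²` ⇒ `T^m ∣ θ_∞`, `m = max(s⁺,s⁻)`;
4. the image of `θ_∞` in `ℤ_p[Γ/pΓ]` lies in `I^m`; on CAPTURED data `Γ/pΓ = C/pC` is the order-`p` quotient of `Cl_K`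
   through which `χ` factors, and that image is the level-0 element `θ̃₀ = e_p ⋆ Θ_K` (Bertolini–Darmon 1996 §2.5 (8),
   §2.10 (10): `e_p = (1 - α⁻¹[σ_𝔭])(1 - α⁻¹[σ_𝔭⁻¹])` for `p` split, `1 - α⁻²` for `p` inert), where
   `Θ_K = Σ_𝔞 φ(x_𝔞)[𝔞]`; under (PO) `e_p` is a UNIT of the local ring `ℤ_p[C/pC]`, so `Θ̄_K ∈ I^m ⊆ I^(s⁺)` —
   this is `stub_tameThetaAugOrder`, typed on `ℤ_p[ℤ/p] = MonoidAlgebra ℤ_[p] (Multiplicative (ZMod p))`;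
5. `Θ̄_K ∈ I^n ⇒ S_χ = χ(Θ̄_K) = Σ_𝔞 ζ^(dlog 𝔞) φ(x_𝔞) ∈ 𝔓^n`, `𝔓 = (ζ - 1)` (`χ(I) ⊆ 𝔓`, `𝔓` the only prime of
   `ℚ(ζ_p)` over `p`) — `stub_augOrder_twistedSum`, pure algebra;
6. `p ∤ M_k`, `k ≤ p - 2` ⇒ `S_χ ∉ 𝔓^(k+1)` — `stub_momentValuation` (shared verbatim with line `birth`, card P1);
hence `s⁺ ≤ k`.  No twin, no Cassels–Tate–Flach form, no unprinted rank-0 leaf.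

`FrozenTwinBoundTame_of_stubs` composes the three stub statements into the TAME sub-crux statement (verbatim the
child statement filed with `route edit --split FrozenTwinBound`), sorry-free; `FrozenTwinBoundTame_of` concludes the
child decl BY NAME once the split is recorded.  `sorry` occurs ONLY inside the three `stub_*` theorems.
-/

namespace Summit.BirchSwinnertonDyer.BirchSwinnertonDyer.Cruxes.FrozenTwinBound.TameLambda

open scoped BigOperators

/-- STUB 1 (card P1, elementary; size M; SHARED verbatim with line `birth`). MOMENTS ⇒ VALUATION: for a prime `p`,
a finite index set `X`, exponents `d : X → ℕ`, weights `f : X → ℤ` and `k ≤ p - 2`: if `p ∤ M_k := Σ_x C(d x, k)·f x`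
then for every primitive `p`-th root of unity `ζ` in the ring of integers of the `p`-th cyclotomic field
`S := Σ_x ζ^(d x)·f x ∉ (ζ - 1)^(k+1)` (`S = Σ_j (ζ-1)^j M_j`, `v_𝔓(ζ-1) = 1`, `v_𝔓(p) = p - 1 > k`;
Washington, Cyclotomic Fields, Lemma 1.4). -/
theorem stub_momentValuation :
    ∀ (p : ℕ) [Fact p.Prime] (X : Type) [Fintype X] (d : X → ℕ) (f : X → ℤ) (k : ℕ), k + 2 ≤ p → ¬ (p : ℤ) ∣ ∑ x : X, ((d x).choose k : ℤ) * f x → ∀ (L : Type) [Field L] [CharZero L] [IsCyclotomicExtension {p} ℚ L] (ζ : NumberField.RingOfIntegers L), IsPrimitiveRoot ζ p → (∑ x : X, ζ ^ (d x) * ((f x : ℤ) : NumberField.RingOfIntegers L)) ∉ (Ideal.span {ζ - 1} : Ideal (NumberField.RingOfIntegers L)) ^ (k + 1) := by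
  sorry

/-- STUB 2 (the LITERATURE LEAF of the line; size L–XL as a formal debt, PRINTED as mathematics).
TAME THETA AUGMENTATION ORDER = Bertolini–Darmon 2005 Cor. 3 in Selmer form, specialised to the order-`p` layer:
for every admissible frozen-twin datum that is TAME (`7 ≤ p`; (PO) `¬ p ∣ a_p² - 1`; captured class-group character,
i.e. for every representative `𝔟` of `σ` prime to `p` with `𝔟^(p^m) = (t)`, `p^(m+1) ∤ t^(p²-1) - t̄^(p²-1)`), the
class-group theta element pushed to the order-`p` quotient,
`Θ̄_K := Σ_𝔞 φ(x_𝔞)·[dlog 𝔞 mod p] ∈ ℤ_p[ℤ/p]`, lies in the `s⁺`-th power of the augmentation ideal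
`I = ker(ℤ_p[ℤ/p] → ℤ_p, [g] ↦ 1)`, `s⁺ = corank_(ℤ_p) Sel_(p^∞)(E/ℚ)`.  Why plausibly true: steps 1–4 of the module
docstring (IMC divisibility CH15 6.14 / PW11 4.1 / BD05 Thm 1; derived heights BD95 2.23 + 3.1 give `2 max(s⁺,s⁻)`;
`𝒪⟦T⟧` domain halves it; BD96 §2.5 (8) level-0 image with the (PO)-unit `e_p`; captured ⇒ `χ` is a character of
`Γ`).  Why it might fail: the Selmer-form reading of Cor. 3 (classical = minimal Selmer over `K_∞` under the side
conditions; control at `p` exact under (PO)) or a residual hypothesis of CH15/PW11 (`p ∤ deg` of the modular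
parametrisation is NOT needed by PW11/CH15 but is by BD05) might hide a gap at `p = 7`, non-squarefree `N⁺`. -/
theorem stub_tameThetaAugOrder :
    ∀ (V : WeierstrassCurve ℚ) [V.IsElliptic] [V.IsGloballyMinimal] (p : ℕ) [Fact p.Prime] (Nplus Nminus m : ℕ) (a b : ℚ) (O : Subring (QuaternionAlgebra ℚ a 0 b)) (K : Type) [Field K] [NumberField K] (ψ : K →ₐ[ℚ] QuaternionAlgebra ℚ a 0 b) (I : Submodule ℤ (QuaternionAlgebra ℚ a 0 b)) (φ : Submodule ℤ (QuaternionAlgebra ℚ a 0 b) → ℤ) (rep : ClassGroup (NumberField.RingOfIntegers K) → nonZeroDivisors (Ideal (NumberField.RingOfIntegers K))) (RI : Set (Submodule ℤ (QuaternionAlgebra ℚ a 0 b))) (σ : ClassGroup (NumberField.RingOfIntegers K)) (dlog : ClassGroup (NumberField.RingOfIntegers K) → ℕ), ((5 ≤ p ∧ V.HasGoodReductionAtPrime p ∧ ¬ (p : ℤ) ∣ V.frobeniusTrace p ∧ V.HasSurjectiveModNGaloisRep p ∧ (∀ q : ℕ, q.Prime → q ∣ V.conductorNorm ℤ → ¬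 (p : ℤ) ∣ (q : ℤ) ^ 2 - 1) ∧ (∀ (q : ℕ) (_ : Fact q.Prime), V.HasMultiplicativeReductionAtPrime q → ¬ (p : ℤ) ∣ padicValRat q V.j)) ∧ (Module.finrank ℚ K = 2 ∧ NumberField.IsTotallyComplex K ∧ NumberField.discr K < -4 ∧ Int.gcd (NumberField.discr K) (V.conductorNorm ℤ * p) = 1) ∧ (V.conductorNorm ℤ = Nplus * Nminus ∧ Nat.Coprime Nplus Nminus ∧ Squarefree Nminus ∧ Odd Nminus.primeFactors.card ∧ (∀ q : ℕ, q.Prime → q ∣ Nplus → ((Ideal.span {(q : ℤ)}).primesOver (NumberField.RingOfIntegers K)).ncard = 2) ∧ (∀ q : ℕ, q.Prime → q ∣ Nminus → ((Ideal.span {(q : ℤ)}).primesOver (NumberField.RingOfIntegers K)).ncard = 1)) ∧ (a < 0 ∧ b < 0 ∧ (∀ (q : ℕ) [Fact q.Prime], (∀ x : QuaternionAlgebra ℚ_[q] (a : ℚ_[q]) 0 (b : ℚ_[q]), x ≠ 0 → IsUnit x) ↔ q ∣ Nminus)) ∧ (∃ O₁ O₂ : Subring (QuaternionAlgebra ℚ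 a 0 b), (∀ S : Subring (QuaternionAlgebra ℚ a 0 b), (S = O₁ ∨ S = O₂) → (S.toAddSubgroup.FG ∧ (∀ d : QuaternionAlgebra ℚ a 0 b, ∃ n : ℤ, n ≠ 0 ∧ n • d ∈ S) ∧ ∀ S' : Subring (QuaternionAlgebra ℚ a 0 b), S'.toAddSubgroup.FG → S ≤ S' → S' = S)) ∧ O = O₁ ⊓ O₂ ∧ O.toAddSubgroup.relIndex O₁.toAddSubgroup = Nplus) ∧ (∀ J : Submodule ℤ (QuaternionAlgebra ℚ a 0 b), J ∈ RI ↔ (J.FG ∧ (∀ d : QuaternionAlgebra ℚ a 0 b, ∃ n : ℤ, n ≠ 0 ∧ n • d ∈ J) ∧ (∀ x : QuaternionAlgebra ℚ a 0 b, (∀ y ∈ J, y * x ∈ J) ↔ x ∈ O) ∧ (∃ J' : Submodule ℤ (QuaternionAlgebra ℚ a 0 b), (∀ x : QuaternionAlgebra ℚ a 0 b, x ∈ J * J' ↔ ∀ y ∈ J, x * y ∈ J) ∧ (∀ x : QuaternionAlgebra ℚ a 0 b, x ∈ J' * J ↔ x ∈ O)))) ∧ ((∀ J ∈ RI, ∀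 β : QuaternionAlgebra ℚ a 0 b, IsUnit β → φ (J.map (AddMonoidHom.mulLeft β).toIntLinearMap) = φ J) ∧ (∀ q : ℕ, q.Prime → ¬ q ∣ V.conductorNorm ℤ → ∀ J ∈ RI, ∑ᶠ J' ∈ {J' : Submodule ℤ (QuaternionAlgebra ℚ a 0 b) | J' ≤ J ∧ J'.toAddSubgroup.relIndex J.toAddSubgroup = q ^ 2 ∧ ∀ y ∈ J', ∀ x ∈ O, y * x ∈ J'}, φ J' = (V.frobeniusTrace q : ℤ) * φ J) ∧ (∃ J ∈ RI, ¬ (p : ℤ) ∣ φ J)) ∧ (I ∈ RI ∧ (∀ x : NumberField.RingOfIntegers K, ∀ y ∈ I, ψ (x : K) * y ∈ I) ∧ (∀ x : K, (∀ y ∈ I, ψ x * y ∈ I) → ∃ z : NumberField.RingOfIntegers K, (z : K) = x) ∧ (∀ 𝔞 : ClassGroup (NumberField.RingOfIntegers K), ClassGroup.mk0 (rep 𝔞) = 𝔞) ∧ (∀ 𝔞 : ClassGroup (NumberField.RingOfIntegers K), Submodule.span ℤ ((fun x : NumberField.RingOfIntegers K => ψ (x : K)) '' ((rep 𝔞 :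 nonZeroDivisors (Ideal (NumberField.RingOfIntegers K))) : Ideal (NumberField.RingOfIntegers K))) * I ∈ RI)) ∧ (1 ≤ m ∧ orderOf σ = p ^ m ∧ ¬ p ^ (m + 1) ∣ Fintype.card (ClassGroup (NumberField.RingOfIntegers K)) ∧ (∀ 𝔞 : ClassGroup (NumberField.RingOfIntegers K), dlog 𝔞 < p ^ m ∧ Nat.Coprime (orderOf (𝔞 * (σ ^ dlog 𝔞)⁻¹)) p))) → (7 ≤ p ∧ ¬ (p : ℤ) ∣ V.frobeniusTrace p ^ 2 - 1 ∧ (∀ (c : K ≃ₐ[ℚ] K), c ≠ AlgEquiv.refl → ∀ (𝔟 : nonZeroDivisors (Ideal (NumberField.RingOfIntegers K))) (t : NumberField.RingOfIntegers K), ClassGroup.mk0 𝔟 = σ → IsCoprime (𝔟 : Ideal (NumberField.RingOfIntegers K)) (Ideal.span {(p : NumberField.RingOfIntegers K)}) → (𝔟 : Ideal (NumberField.RingOfIntegers K)) ^ (p ^ m) = Ideal.span {t} → ¬ ∃ z : NumberField.RingOfIntegers K, (t : K) ^ (p ^ 2 - 1) - c ((t : K) ^ (p ^ 2 - 1)) =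 (p : K) ^ (m + 1) * (z : K))) → (∑ 𝔞 : ClassGroup (NumberField.RingOfIntegers K), MonoidAlgebra.single (Multiplicative.ofAdd ((dlog 𝔞 : ℕ) : ZMod p)) ((φ (Submodule.span ℤ ((fun x : NumberField.RingOfIntegers K => ψ (x : K)) '' ((rep 𝔞 : nonZeroDivisors (Ideal (NumberField.RingOfIntegers K))) : Ideal (NumberField.RingOfIntegers K))) * I) : ℤ) : ℤ_[p])) ∈ (RingHom.ker (MonoidAlgebra.lift ℤ_[p] ℤ_[p] (Multiplicative (ZMod p)) (1 : Multiplicative (ZMod p) →* ℤ_[p]))) ^ (V.selmerCorank p) := by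
  sorry

/-- STUB 3 (pure commutative algebra; size M; provable now). AUGMENTATION ORDER ⇒ TWISTED-SUM VALUATION: for a prime
`p`, a finite set `X`, `d : X → ℕ`, `f : X → ℤ`: if `Σ_x f(x)·[d x mod p] ∈ I^n` in `ℤ_p[ℤ/p]` (`I` the augmentation
ideal) then for every primitive `p`-th root of unity `ζ` in `𝓞(ℚ(ζ_p))`, `Σ_x ζ^(d x) f(x) ∈ (ζ - 1)^n`.  Proof sketch:
the character `[g] ↦ ζ^g` extends to `ℤ_p[ℤ/p] → 𝓞 ⊗ ℤ_p = 𝓞_𝔓` and maps `I` into `(ζ - 1)`; `𝔓 = (ζ - 1)` is the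
unique prime over `p`, so `(ζ-1)^n 𝓞_𝔓 ∩ 𝓞 = 𝔓^n` (equivalently: `∃ N`, `p ∤ N`, `N·Θ ∈ I^n_(ℤ[ℤ/p])`, then evaluate). -/
theorem stub_augOrder_twistedSum :
    ∀ (p : ℕ) [Fact p.Prime] (X : Type) [Fintype X] (d : X → ℕ) (f : X → ℤ) (n : ℕ), (∑ x : X, MonoidAlgebra.single (Multiplicative.ofAdd ((d x : ℕ) : ZMod p)) ((f x : ℤ) : ℤ_[p])) ∈ (RingHom.ker (MonoidAlgebra.lift ℤ_[p] ℤ_[p] (Multiplicative (ZMod p)) (1 : Multiplicative (ZMod p) →* ℤ_[p]))) ^ n → ∀ (L : Type) [Field L] [CharZero L] [IsCyclotomicExtension {p} ℚ L] (ζ : NumberField.RingOfIntegers L), IsPrimitiveRoot ζ p → (∑ x : X, ζ ^ (d x) * ((f x : ℤ) : NumberField.RingOfIntegers L)) ∈ (Ideal.span {ζ - 1} : Ideal (NumberField.RingOfIntegers L)) ^ n := by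
  sorry

/-! ## Assembly (sorry-free) -/

/-- ASSEMBLY (kernel-checked): the three stub STATEMENTS imply the TAME sub-crux statement (verbatim the child
`FrozenTwin.FrozenTwinBoundTame` filed by `route edit --split FrozenTwinBound`).  Given tame admissible data and
`p ∤ M_k` (`k + 2 ≤ p`): stub 2 puts `Θ̄_K` in `I^(s⁺)`, stub 3 turns this into `S_χ ∈ 𝔓^(s⁺)` in
`L := CyclotomicField p ℚ` at Mathlib's `zeta`, stub 1 gives `S_χ ∉ 𝔓^(k+1)`; if `s⁺ ≥ k + 1` then
`𝔓^(s⁺) ≤ 𝔓^(k+1)`, contradiction; hence `s⁺ ≤ k`. -/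
theorem FrozenTwinBoundTame_of_stubs
    (h1 : ∀ (p : ℕ) [Fact p.Prime] (X : Type) [Fintype X] (d : X → ℕ) (f : X → ℤ) (k : ℕ), k + 2 ≤ p → ¬ (p : ℤ) ∣ ∑ x : X, ((d x).choose k : ℤ) * f x → ∀ (L : Type) [Field L] [CharZero L] [IsCyclotomicExtension {p} ℚ L] (ζ : NumberField.RingOfIntegers L), IsPrimitiveRoot ζ p → (∑ x : X, ζ ^ (d x) * ((f x : ℤ) : NumberField.RingOfIntegers L)) ∉ (Ideal.span {ζ - 1} : Ideal (NumberField.RingOfIntegers L)) ^ (k + 1))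
    (h2 : ∀ (V : WeierstrassCurve ℚ) [V.IsElliptic] [V.IsGloballyMinimal] (p : ℕ) [Fact p.Prime] (Nplus Nminus m : ℕ) (a b : ℚ) (O : Subring (QuaternionAlgebra ℚ a 0 b)) (K : Type) [Field K] [NumberField K] (ψ : K →ₐ[ℚ] QuaternionAlgebra ℚ a 0 b) (I : Submodule ℤ (QuaternionAlgebra ℚ a 0 b)) (φ : Submodule ℤ (QuaternionAlgebra ℚ a 0 b) → ℤ) (rep : ClassGroup (NumberField.RingOfIntegers K) → nonZeroDivisors (Ideal (NumberField.RingOfIntegers K))) (RI : Set (Submodule ℤ (QuaternionAlgebra ℚ a 0 b))) (σ : ClassGroup (NumberField.RingOfIntegers K)) (dlog : ClassGroup (NumberField.RingOfIntegers K) → ℕ), ((5 ≤ p ∧ V.HasGoodReductionAtPrime p ∧ ¬ (p : ℤ) ∣ V.frobeniusTrace p ∧ V.HasSurjectiveModNGaloisRep p ∧ (∀ q : ℕ, q.Prime → q ∣ V.conductorNorm ℤ → ¬ (p : ℤ) ∣ (q : ℤ) ^ 2 - 1) ∧ (∀ (q : ℕ) (_ : Fact q.Prime), V.HasMultiplicativeReductionAtPrime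 q → ¬ (p : ℤ) ∣ padicValRat q V.j)) ∧ (Module.finrank ℚ K = 2 ∧ NumberField.IsTotallyComplex K ∧ NumberField.discr K < -4 ∧ Int.gcd (NumberField.discr K) (V.conductorNorm ℤ * p) = 1) ∧ (V.conductorNorm ℤ = Nplus * Nminus ∧ Nat.Coprime Nplus Nminus ∧ Squarefree Nminus ∧ Odd Nminus.primeFactors.card ∧ (∀ q : ℕ, q.Prime → q ∣ Nplus → ((Ideal.span {(q : ℤ)}).primesOver (NumberField.RingOfIntegers K)).ncard = 2) ∧ (∀ q : ℕ, q.Prime → q ∣ Nminus → ((Ideal.span {(q : ℤ)}).primesOver (NumberField.RingOfIntegers K)).ncard = 1)) ∧ (a < 0 ∧ b < 0 ∧ (∀ (q : ℕ) [Fact q.Prime], (∀ x : QuaternionAlgebra ℚ_[q] (a : ℚ_[q]) 0 (b : ℚ_[q]), x ≠ 0 → IsUnit x) ↔ q ∣ Nminus)) ∧ (∃ O₁ O₂ : Subring (QuaternionAlgebra ℚ a 0 b), (∀ S : Subring (QuaternionAlgebra ℚ a 0 b), (S = O₁ ∨ S = O₂) → (S.toAddSubgroup.FG ∧ (∀ d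 : QuaternionAlgebra ℚ a 0 b, ∃ n : ℤ, n ≠ 0 ∧ n • d ∈ S) ∧ ∀ S' : Subring (QuaternionAlgebra ℚ a 0 b), S'.toAddSubgroup.FG → S ≤ S' → S' = S)) ∧ O = O₁ ⊓ O₂ ∧ O.toAddSubgroup.relIndex O₁.toAddSubgroup = Nplus) ∧ (∀ J : Submodule ℤ (QuaternionAlgebra ℚ a 0 b), J ∈ RI ↔ (J.FG ∧ (∀ d : QuaternionAlgebra ℚ a 0 b, ∃ n : ℤ, n ≠ 0 ∧ n • d ∈ J) ∧ (∀ x : QuaternionAlgebra ℚ a 0 b, (∀ y ∈ J, y * x ∈ J) ↔ x ∈ O) ∧ (∃ J' : Submodule ℤ (QuaternionAlgebra ℚ a 0 b), (∀ x : QuaternionAlgebra ℚ a 0 b, x ∈ J * J' ↔ ∀ y ∈ J, x * y ∈ J) ∧ (∀ x : QuaternionAlgebra ℚ a 0 b, x ∈ J' * J ↔ x ∈ O)))) ∧ ((∀ J ∈ RI, ∀ β : QuaternionAlgebra ℚ a 0 b, IsUnit β → φ (J.map (AddMonoidHom.mulLeft β).toIntLinearMap) = φ J) ∧ (∀ q :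 ℕ, q.Prime → ¬ q ∣ V.conductorNorm ℤ → ∀ J ∈ RI, ∑ᶠ J' ∈ {J' : Submodule ℤ (QuaternionAlgebra ℚ a 0 b) | J' ≤ J ∧ J'.toAddSubgroup.relIndex J.toAddSubgroup = q ^ 2 ∧ ∀ y ∈ J', ∀ x ∈ O, y * x ∈ J'}, φ J' = (V.frobeniusTrace q : ℤ) * φ J) ∧ (∃ J ∈ RI, ¬ (p : ℤ) ∣ φ J)) ∧ (I ∈ RI ∧ (∀ x : NumberField.RingOfIntegers K, ∀ y ∈ I, ψ (x : K) * y ∈ I) ∧ (∀ x : K, (∀ y ∈ I, ψ x * y ∈ I) → ∃ z : NumberField.RingOfIntegers K, (z : K) = x) ∧ (∀ 𝔞 : ClassGroup (NumberField.RingOfIntegers K), ClassGroup.mk0 (rep 𝔞) = 𝔞) ∧ (∀ 𝔞 : ClassGroup (NumberField.RingOfIntegers K), Submodule.span ℤ ((fun x : NumberField.RingOfIntegers K => ψ (x : K)) '' ((rep 𝔞 : nonZeroDivisors (Ideal (NumberField.RingOfIntegers K))) : Ideal (NumberField.RingOfIntegers K))) * I ∈ RI)) ∧ (1 ≤ m ∧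 orderOf σ = p ^ m ∧ ¬ p ^ (m + 1) ∣ Fintype.card (ClassGroup (NumberField.RingOfIntegers K)) ∧ (∀ 𝔞 : ClassGroup (NumberField.RingOfIntegers K), dlog 𝔞 < p ^ m ∧ Nat.Coprime (orderOf (𝔞 * (σ ^ dlog 𝔞)⁻¹)) p))) → (7 ≤ p ∧ ¬ (p : ℤ) ∣ V.frobeniusTrace p ^ 2 - 1 ∧ (∀ (c : K ≃ₐ[ℚ] K), c ≠ AlgEquiv.refl → ∀ (𝔟 : nonZeroDivisors (Ideal (NumberField.RingOfIntegers K))) (t : NumberField.RingOfIntegers K), ClassGroup.mk0 𝔟 = σ → IsCoprime (𝔟 : Ideal (NumberField.RingOfIntegers K)) (Ideal.span {(p : NumberField.RingOfIntegers K)}) → (𝔟 : Ideal (NumberField.RingOfIntegers K)) ^ (p ^ m) = Ideal.span {t} → ¬ ∃ z : NumberField.RingOfIntegers K, (t : K) ^ (p ^ 2 - 1) - c ((t : K) ^ (p ^ 2 - 1)) = (p : K) ^ (m + 1) * (z : K))) → (∑ 𝔞 : ClassGroup (NumberField.RingOfIntegers K), MonoidAlgebra.single (Multiplicative.ofAdd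 ((dlog 𝔞 : ℕ) : ZMod p)) ((φ (Submodule.span ℤ ((fun x : NumberField.RingOfIntegers K => ψ (x : K)) '' ((rep 𝔞 : nonZeroDivisors (Ideal (NumberField.RingOfIntegers K))) : Ideal (NumberField.RingOfIntegers K))) * I) : ℤ) : ℤ_[p])) ∈ (RingHom.ker (MonoidAlgebra.lift ℤ_[p] ℤ_[p] (Multiplicative (ZMod p)) (1 : Multiplicative (ZMod p) →* ℤ_[p]))) ^ (V.selmerCorank p))
    (h3 : ∀ (p : ℕ) [Fact p.Prime] (X : Type) [Fintype X] (d : X → ℕ) (f : X → ℤ) (n : ℕ), (∑ x : X, MonoidAlgebra.single (Multiplicative.ofAdd ((d x : ℕ) : ZMod p)) ((f x : ℤ) : ℤ_[p])) ∈ (RingHom.ker (MonoidAlgebra.lift ℤ_[p] ℤ_[p] (Multiplicative (ZMod p)) (1 : Multiplicative (ZMod p) →* ℤ_[p]))) ^ n → ∀ (L : Type) [Field L] [CharZero L] [IsCyclotomicExtension {p} ℚ L] (ζ : NumberField.RingOfIntegers L), IsPrimitiveRoot ζ p → (∑ x : X, ζ ^ (d x) * ((f x : ℤ) : NumberField.RingOfIntegers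 L)) ∈ (Ideal.span {ζ - 1} : Ideal (NumberField.RingOfIntegers L)) ^ n) :
    ∀ (V : WeierstrassCurve ℚ) [V.IsElliptic] [V.IsGloballyMinimal] (p : ℕ) [Fact p.Prime] (Nplus Nminus m : ℕ) (a b : ℚ) (O : Subring (QuaternionAlgebra ℚ a 0 b)) (K : Type) [Field K] [NumberField K] (ψ : K →ₐ[ℚ] QuaternionAlgebra ℚ a 0 b) (I : Submodule ℤ (QuaternionAlgebra ℚ a 0 b)) (φ : Submodule ℤ (QuaternionAlgebra ℚ a 0 b) → ℤ) (rep : ClassGroup (NumberField.RingOfIntegers K) → nonZeroDivisors (Ideal (NumberField.RingOfIntegers K))) (RI : Set (Submodule ℤ (QuaternionAlgebra ℚ a 0 b))) (σ : ClassGroup (NumberField.RingOfIntegers K)) (dlog : ClassGroup (NumberField.RingOfIntegers K) → ℕ), ((5 ≤ p ∧ V.HasGoodReductionAtPrime p ∧ ¬ (p : ℤ) ∣ V.frobeniusTrace p ∧ V.HasSurjectiveModNGaloisRep p ∧ (∀ q : ℕ, q.Prime → q ∣ V.conductorNorm ℤ → ¬ (p : ℤ) ∣ (q : ℤ) ^ 2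 - 1) ∧ (∀ (q : ℕ) (_ : Fact q.Prime), V.HasMultiplicativeReductionAtPrime q → ¬ (p : ℤ) ∣ padicValRat q V.j)) ∧ (Module.finrank ℚ K = 2 ∧ NumberField.IsTotallyComplex K ∧ NumberField.discr K < -4 ∧ Int.gcd (NumberField.discr K) (V.conductorNorm ℤ * p) = 1) ∧ (V.conductorNorm ℤ = Nplus * Nminus ∧ Nat.Coprime Nplus Nminus ∧ Squarefree Nminus ∧ Odd Nminus.primeFactors.card ∧ (∀ q : ℕ, q.Prime → q ∣ Nplus → ((Ideal.span {(q : ℤ)}).primesOver (NumberField.RingOfIntegers K)).ncard = 2) ∧ (∀ q : ℕ, q.Prime → q ∣ Nminus → ((Ideal.span {(q : ℤ)}).primesOver (NumberField.RingOfIntegers K)).ncard = 1)) ∧ (a < 0 ∧ b < 0 ∧ (∀ (q : ℕ) [Fact q.Prime], (∀ x : QuaternionAlgebra ℚ_[q] (a : ℚ_[q]) 0 (b : ℚ_[q]), x ≠ 0 → IsUnit x) ↔ q ∣ Nminus)) ∧ (∃ O₁ O₂ : Subring (QuaternionAlgebra ℚ a 0 b), (∀ S : Subring (QuaternionAlgebra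 ℚ a 0 b), (S = O₁ ∨ S = O₂) → (S.toAddSubgroup.FG ∧ (∀ d : QuaternionAlgebra ℚ a 0 b, ∃ n : ℤ, n ≠ 0 ∧ n • d ∈ S) ∧ ∀ S' : Subring (QuaternionAlgebra ℚ a 0 b), S'.toAddSubgroup.FG → S ≤ S' → S' = S)) ∧ O = O₁ ⊓ O₂ ∧ O.toAddSubgroup.relIndex O₁.toAddSubgroup = Nplus) ∧ (∀ J : Submodule ℤ (QuaternionAlgebra ℚ a 0 b), J ∈ RI ↔ (J.FG ∧ (∀ d : QuaternionAlgebra ℚ a 0 b, ∃ n : ℤ, n ≠ 0 ∧ n • d ∈ J) ∧ (∀ x : QuaternionAlgebra ℚ a 0 b, (∀ y ∈ J, y * x ∈ J) ↔ x ∈ O) ∧ (∃ J' : Submodule ℤ (QuaternionAlgebra ℚ a 0 b), (∀ x : QuaternionAlgebra ℚ a 0 b, x ∈ J * J' ↔ ∀ y ∈ J, x * y ∈ J) ∧ (∀ x : QuaternionAlgebra ℚ a 0 b, x ∈ J' * J ↔ x ∈ O)))) ∧ ((∀ J ∈ RI, ∀ β : QuaternionAlgebra ℚ a 0 b, IsUnit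 β → φ (J.map (AddMonoidHom.mulLeft β).toIntLinearMap) = φ J) ∧ (∀ q : ℕ, q.Prime → ¬ q ∣ V.conductorNorm ℤ → ∀ J ∈ RI, ∑ᶠ J' ∈ {J' : Submodule ℤ (QuaternionAlgebra ℚ a 0 b) | J' ≤ J ∧ J'.toAddSubgroup.relIndex J.toAddSubgroup = q ^ 2 ∧ ∀ y ∈ J', ∀ x ∈ O, y * x ∈ J'}, φ J' = (V.frobeniusTrace q : ℤ) * φ J) ∧ (∃ J ∈ RI, ¬ (p : ℤ) ∣ φ J)) ∧ (I ∈ RI ∧ (∀ x : NumberField.RingOfIntegers K, ∀ y ∈ I, ψ (x : K) * y ∈ I) ∧ (∀ x : K, (∀ y ∈ I, ψ x * y ∈ I) → ∃ z : NumberField.RingOfIntegers K, (z : K) = x) ∧ (∀ 𝔞 : ClassGroup (NumberField.RingOfIntegers K), ClassGroup.mk0 (rep 𝔞) = 𝔞) ∧ (∀ 𝔞 : ClassGroup (NumberField.RingOfIntegers K), Submodule.span ℤ ((fun x : NumberField.RingOfIntegers K => ψ (x : K)) '' ((rep 𝔞 : nonZeroDivisors (Ideal (NumberField.RingOfIntegers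 K))) : Ideal (NumberField.RingOfIntegers K))) * I ∈ RI)) ∧ (1 ≤ m ∧ orderOf σ = p ^ m ∧ ¬ p ^ (m + 1) ∣ Fintype.card (ClassGroup (NumberField.RingOfIntegers K)) ∧ (∀ 𝔞 : ClassGroup (NumberField.RingOfIntegers K), dlog 𝔞 < p ^ m ∧ Nat.Coprime (orderOf (𝔞 * (σ ^ dlog 𝔞)⁻¹)) p))) → (7 ≤ p ∧ ¬ (p : ℤ) ∣ V.frobeniusTrace p ^ 2 - 1 ∧ (∀ (c : K ≃ₐ[ℚ] K), c ≠ AlgEquiv.refl → ∀ (𝔟 : nonZeroDivisors (Ideal (NumberField.RingOfIntegers K))) (t : NumberField.RingOfIntegers K), ClassGroup.mk0 𝔟 = σ → IsCoprime (𝔟 : Ideal (NumberField.RingOfIntegers K)) (Ideal.span {(p : NumberField.RingOfIntegers K)}) → (𝔟 : Ideal (NumberField.RingOfIntegers K)) ^ (p ^ m) = Ideal.span {t} → ¬ ∃ z : NumberField.RingOfIntegers K, (t : K) ^ (p ^ 2 - 1) - c ((t : K) ^ (p ^ 2 - 1)) = (p : K) ^ (m + 1) * (z : K))) → ∀ k :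 ℕ, k + 2 ≤ p → ¬ (p : ℤ) ∣ ∑ 𝔞 : ClassGroup (NumberField.RingOfIntegers K), ((dlog 𝔞).choose k : ℤ) * φ (Submodule.span ℤ ((fun x : NumberField.RingOfIntegers K => ψ (x : K)) '' ((rep 𝔞 : nonZeroDivisors (Ideal (NumberField.RingOfIntegers K))) : Ideal (NumberField.RingOfIntegers K))) * I) → V.selmerCorank p ≤ k := by
  intro V _ _ p hp Nplus Nminus m a b O K _ _ ψ I φ rep RI σ dlog hH hP k hkp hndvd
  haveI : NeZero p := ⟨hp.out.ne_zero⟩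
  haveI : IsCyclotomicExtension {p} ℚ (CyclotomicField p ℚ) :=
    CyclotomicField.isCyclotomicExtension p ℚ
  have hζ := (IsCyclotomicExtension.zeta_spec p ℚ (CyclotomicField p ℚ)).toInteger_isPrimitiveRoot
  -- stub 1: `S_χ ∉ 𝔓^(k+1)`
  have hval := h1 p (ClassGroup (NumberField.RingOfIntegers K)) dlog
    (fun 𝔞 => φ (Submodule.span ℤ ((fun x : NumberField.RingOfIntegers K => ψ (x : K)) '' ((rep 𝔞 : nonZeroDivisors (Ideal (NumberField.RingOfIntegers K))) : Ideal (NumberField.RingOfIntegers K))) * I)) k hkp hndvd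
    (CyclotomicField p ℚ) _ hζ
  -- stub 2: `Θ̄_K ∈ I^(s⁺)`; stub 3: `S_χ ∈ 𝔓^(s⁺)`
  have haug := h2 V p Nplus Nminus m a b O K ψ I φ rep RI σ dlog hH hP
  have hmem := h3 p (ClassGroup (NumberField.RingOfIntegers K)) dlog
    (fun 𝔞 => φ (Submodule.span ℤ ((fun x : NumberField.RingOfIntegers K => ψ (x : K)) '' ((rep 𝔞 : nonZeroDivisors (Ideal (NumberField.RingOfIntegers K))) : Ideal (NumberField.RingOfIntegers K))) * I)) (V.selmerCorank p) haug
    (CyclotomicField p ℚ) _ hζ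
  by_contra hlt
  exact hval (Ideal.pow_le_pow_right (Nat.succ_le_of_lt (not_le.mp hlt)) hmem)

end Summit.BirchSwinnertonDyer.BirchSwinnertonDyer.Cruxes.FrozenTwinBound.TameLambda
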